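import Summits.CriticalPhenomena.PercolationContinuityZ3.Theorems.PercNearOneGluingNoHeavyLowerTailAntitheticNestedTop
import HarnessLib

/-!
# `NoHeavyLowerTail` (stmt-CriticalPhenomena-4575) — antithetic cluster pairs: **LEMMA D2Q-T (the degree-2 reduction to the TOP event)
# and THEOREM T-EAR (any core `K` plus a chorded ear at `s`, conditional on the TOP hypothesis of `K` alone)** (prim-hp-2 gen 69,
# HOME/MEMO-gen69.md §1)

Support file (`--supports stmt-CriticalPhenomena-4575`, hull-port prover `prim-hp-2`, gen 69).  No definitions, no named facts, no sorries;
standard axioms.  VERTEX version, setting and notation of …AntitheticConeFibre / …AntitheticNestedTop (`T ⊆ Sym2 V` the red pairs,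
`X T = openCluster (T ∩ E) s` the red and `Y T = openCluster (Tᶜ ∩ E) s` the blue vertex cluster of the source `s`).

THE TOP EVENT.  For a rooted graph `(K, s)` and a vertex `P` put
  TOP_shift(K; P):  `0 ≤ Σ_{T : P ∈ X T, P ∉ Y T} (F⁺(X T) − F⁻(Y T))·(G⁺(X T) − G⁻(Y T))`  for all monotone `F⁻ ≤ F⁺`, `G⁻ ≤ G⁺`
— the DIAGONAL mixed event `(P, P)` of the handle machinery ((M)_shift(K; P, Q) is the same sum over `{P ∈ X T, Q ∉ Y T}`).  It holds
termwise when the tops of `K` at `P` are nested (`Y T ⊆ X T` on the event: …AntitheticNestedTop, apex and theta criteria), for every `K`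
satisfying the cone hypothesis at `P` (THEOREM M1 `TwoStage.Cone.mixed_shift_nonneg` with `P = Q`), and — by exact symmetric separability LPs
and the two-copy min-cut adversary — for every connected rooted graph on ≤ 6 vertices and every `P`, nested or not (HOME/MEMO-gen69.md §2:
CONJECTURE T; no failure is known on 7 and 8 vertices either).

**LEMMA D2Q-T** (`TopEar.mixed_shift_nonneg_of_top`).  Let `K` avoid the vertex `Q` and put `E = K + sQ + QP` (`s, P, Q` distinct).
Then (M)_shift(E; P, Q) ≥ 0 as soon as TOP_shift(K; P) holds.  Proof = the split of LEMMA D2Q (…AntitheticNestedTop) along the colours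
of `sQ, QP`: `sQ` blue ⇒ `Q ∈ Y T`, no event; both red ⇒ the event is automatic and the part is the cylinder sum over `{T ⊇ {sQ, QP}}`,
nonnegative for EVERY graph (`NestedTop.cylinder_shift_sum_nonneg`: uniform block Fubini + Harris + marginal domination); `sQ` red and
`QP` blue ⇒ `X_E T = X_K T ∪ {Q}`, `Y_E T = Y_K T` and the event is `{P ∈ X_K T ∖ Y_K T}`, so by block Fubini over the block `{sQ, QP}`
this part is `¼ |Set (Sym2 V)|⁻¹·#… ×` the TOP sum of `K` at `P` for the shifted pair `F⁺(· ∪ {Q}) ≥ F⁻`, `G⁺(· ∪ {Q}) ≥ G⁻`.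
So the nested-tops hypothesis of LEMMA D2Q is replaced by the TOP hypothesis, which is its exact content.

**THEOREM T-EAR** (`TopEar.chorded_ear_vertex_sum_nonneg`).  `K` loop-free avoiding `Q`; `s, P, Q` distinct; an arm `P = u 0, u 1, …,
u a = y` of fresh vertices and `x` fresh joined to `y` and `Q` (`yQ ∉ E ∪ arm`, so `a ≥ 1`).  The graph is `K` plus the cycle
`Q – P – u 1 – … – y – x – Q` (length `a + 3 ≥ 4`, meeting `K` in `P` only) plus the chord `sQ` — equivalently `K` plus an ear
`s – Q – x – y – … – P` with ≥ 3 internal vertices and the chord `QP`.  If TOP_shift(K; P) holds then for all monotone `F, G`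
  `0 ≤ Σ_{ω : ¬(x ∈ X ω ∧ x ∈ Y ω)} (F(X ω) − F(Y ω))·(G(X ω) − G(Y ω))`
— the vertex antithetic inequality at `R = {x}` / CONJECTURE Δ2 at `x`.  Proof: the shifted handle principle with a `z`-arm of length 0
(`Pendant.handle_vertex_sum_nonneg_of_shift`, its (⊕_j) hypotheses vacuous) and LEMMA D2Q-T.  THEOREMS TE/AE of …AntitheticNestedTop are
the nested instances; every exact TOP certificate (…AntitheticSepDecide) of a core `K` is an instance; CONJECTURE T would make it
unconditional for every `K`.
[cite: VandenbergHaggstromKahn2005, §1 p. 6 ("Harris' inequality"), §1 p. 3 (open cluster `C_s`)]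
-/

noncomputable section

namespace Summit.CriticalPhenomena.PercolationContinuityZ3.Theorems

open Literature.Probability.Percolation
open scoped Classical

namespace Antithetic

namespace TopEar

variable {V : Type*} [Fintype V]

omit [Fintype V] in
/-- A vertex `v ≠ a` in the open cluster of `a` lies on an open pair. [folklore] -/
theorem exists_pair_of_mem_cluster {η : Set (Sym2 V)} {a v : V} (hva : v ≠ a) (hv : v ∈ openCluster η a) :
    ∃ u, s(v, u) ∈ η := by
  obtain ⟨p⟩ := (show (openGraph η).Reachable a v from hv)
  cases hp : p.reverse with
  | nil => exact absurd rfl hva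
  | cons hadj _ =>
    rw [openGraph_adj] at hadj
    exact ⟨_, hadj.1⟩

omit [Fintype V] in
/-- Clusters of `K` do not see pairs outside `K`: removing a set `A` of pairs disjoint from `K` from the colouring does not change
`openCluster (T ∩ K)`. [folklore] -/
theorem inter_diff_eq {K A : Set (Sym2 V)} (hA : ∀ e ∈ A, e ∉ K) (T : Set (Sym2 V)) : (T \ A) ∩ K = T ∩ K := by
  ext e
  simp only [Set.mem_inter_iff, Set.mem_sdiff]
  exact ⟨fun h => ⟨h.1.1, h.2⟩, fun h => ⟨⟨h.1, fun hA' => hA e hA' h.2⟩, h.2⟩⟩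

omit [Fintype V] in
/-- Companion of `inter_diff_eq` for the complementary colouring. [folklore] -/
theorem compl_diff_inter_eq {K A : Set (Sym2 V)} (hA : ∀ e ∈ A, e ∉ K) (T : Set (Sym2 V)) : (T \ A)ᶜ ∩ K = Tᶜ ∩ K := by
  ext e
  simp only [Set.mem_inter_iff, Set.mem_compl_iff, Set.mem_sdiff, not_and, not_not]
  exact ⟨fun h => ⟨fun hT => hA e (h.1 hT) h.2, h.2⟩, fun h => ⟨fun hT => absurd hT h.1, h.2⟩⟩

omit [Fintype V] in
/-- **Red cluster of `K + sQ + QP` when `sQ` is red and `QP` blue**: it is `X_K T ∪ {Q}` (`Q` on no pair of `K`). [this work] -/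
theorem red_cluster_eq {K : Set (Sym2 V)} {s P Q : V} (hsQ : s ≠ Q) (hQK : ∀ e ∈ K, Q ∉ e) {T : Set (Sym2 V)}
    (h1 : s(s, Q) ∈ T) (h2 : s(Q, P) ∉ T) :
    openCluster (T ∩ insert s(s, Q) (insert s(Q, P) K)) s = insert Q (openCluster (T ∩ K) s) := by
  apply Set.Subset.antisymm
  · refine TwoStage.Fan.cluster_subset_of_closed (Set.mem_insert_of_mem _ (mem_openCluster_self _ s)) ?_
    intro u w hu huw
    obtain ⟨⟨hT, hE⟩, hne⟩ := (openGraph_adj _ u w).1 huw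
    rcases hE with hE | hE | hE
    · -- the pair `sQ`
      rcases Sym2.eq_iff.1 hE with ⟨-, rfl⟩ | ⟨rfl, rfl⟩
      · exact Set.mem_insert _ _
      · exact Set.mem_insert_of_mem _ (mem_openCluster_self _ _)
    · exact absurd (hE ▸ hT) h2
    · -- a pair of `K`: `u ≠ Q`
      rcases hu with rfl | hu
      · exact absurd (Sym2.mem_mk_left u w) (hQK _ hE)
      · exact Set.mem_insert_of_mem _ (TwoStage.Cone.mem_cluster_of_adj hu ((openGraph_adj _ u w).2 ⟨⟨hT, hE⟩, hne⟩))
  · intro v hv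
    rcases hv with rfl | hv
    · exact TwoStage.Cone.mem_cluster_of_adj (mem_openCluster_self _ s)
        ((openGraph_adj _ s v).2 ⟨⟨h1, Set.mem_insert _ _⟩, hsQ⟩)
    · exact Freeze.openCluster_mono (Set.inter_subset_inter_right T
        ((Set.subset_insert _ _).trans (Set.subset_insert _ _))) s hv

omit [Fintype V] in
/-- **Blue cluster of `K + sQ + QP` when `sQ` is red and `P ∉ Y_K T`**: it is `Y_K T`. [this work] -/
theorem blue_cluster_eq {K : Set (Sym2 V)} {s P Q : V} (hsQ : s ≠ Q) (hQK : ∀ e ∈ K, Q ∉ e) {T : Set (Sym2 V)}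
    (h1 : s(s, Q) ∈ T) (hP : P ∉ openCluster (Tᶜ ∩ K) s) :
    openCluster (Tᶜ ∩ insert s(s, Q) (insert s(Q, P) K)) s = openCluster (Tᶜ ∩ K) s := by
  apply Set.Subset.antisymm
  · refine TwoStage.Fan.cluster_subset_of_closed (mem_openCluster_self _ s) ?_
    intro u w hu huw
    obtain ⟨⟨hT, hE⟩, hne⟩ := (openGraph_adj _ u w).1 huw
    rcases hE with hE | hE | hE
    · exact absurd (hE ▸ h1) hT
    · -- the pair `QP`: `u ∈ {Q, P}`, but `P ∉ Y_K T` and `Q ∉ Y_K T`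
      rcases Sym2.eq_iff.1 hE with ⟨rfl, -⟩ | ⟨rfl, -⟩
      · obtain ⟨u', hu'⟩ := exists_pair_of_mem_cluster hsQ.symm hu
        exact absurd (Sym2.mem_mk_left _ u') (hQK _ hu'.2)
      · exact absurd hu hP
    · exact TwoStage.Cone.mem_cluster_of_adj hu ((openGraph_adj _ u w).2 ⟨⟨hT, hE⟩, hne⟩)
  · exact Freeze.openCluster_mono (Set.inter_subset_inter_right Tᶜ
      ((Set.subset_insert _ _).trans (Set.subset_insert _ _))) s

/-- **LEMMA D2Q-T (degree-2 reduction to the TOP event).**  `K` a pair set avoiding `Q`; `s, P, Q` pairwise distinct;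
`E = K + sQ + QP`.  If TOP_shift(K; P) holds — `0 ≤ Σ_{T : P ∈ X_K T, P ∉ Y_K T} (F⁺(X_K T) − F⁻(Y_K T))·(G⁺(X_K T) − G⁻(Y_K T))` for all
monotone `F⁻ ≤ F⁺`, `G⁻ ≤ G⁺` — then (M)_shift(E; P, Q) holds:
`0 ≤ Σ_{T : P ∈ X_E T, Q ∉ Y_E T} (F⁺(X_E T) − F⁻(Y_E T))·(G⁺(X_E T) − G⁻(Y_E T))`.  (Cylinder over `{sQ, QP}` red — nonnegative for every
graph — plus, for `sQ` red and `QP` blue, the TOP sum of `K` for the shifted pair `F⁺(· ∪ {Q})`, `G⁺(· ∪ {Q})`.) [this work] -/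
theorem mixed_shift_nonneg_of_top (K : Set (Sym2 V)) (s P Q : V) (hsQ : s ≠ Q) (hPQ : P ≠ Q) (hsP : s ≠ P)
    (hQK : ∀ e ∈ K, Q ∉ e)
    (htop : ∀ Fp Fm Gp Gm : Set V → ℝ, Monotone Fp → Monotone Fm → (∀ S, Fm S ≤ Fp S) →
      Monotone Gp → Monotone Gm → (∀ S, Gm S ≤ Gp S) →
      0 ≤ ∑ T ∈ Finset.univ.filter (fun T : Set (Sym2 V) => P ∈ openCluster (T ∩ K) s ∧ P ∉ openCluster (Tᶜ ∩ K) s),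
        (Fp (openCluster (T ∩ K) s) - Fm (openCluster (Tᶜ ∩ K) s)) * (Gp (openCluster (T ∩ K) s) - Gm (openCluster (Tᶜ ∩ K) s)))
    (Fp Fm Gp Gm : Set V → ℝ) (hFp : Monotone Fp) (hFm : Monotone Fm) (hF : ∀ S, Fm S ≤ Fp S)
    (hGp : Monotone Gp) (hGm : Monotone Gm) (hG : ∀ S, Gm S ≤ Gp S) :
    0 ≤ ∑ T ∈ Finset.univ.filter (fun T : Set (Sym2 V) =>
        P ∈ openCluster (T ∩ insert s(s, Q) (insert s(Q, P) K)) s ∧ Q ∉ openCluster (Tᶜ ∩ insert s(s, Q) (insert s(Q, P) K)) s),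
      (Fp (openCluster (T ∩ insert s(s, Q) (insert s(Q, P) K)) s) - Fm (openCluster (Tᶜ ∩ insert s(s, Q) (insert s(Q, P) K)) s)) *
        (Gp (openCluster (T ∩ insert s(s, Q) (insert s(Q, P) K)) s) - Gm (openCluster (Tᶜ ∩ insert s(s, Q) (insert s(Q, P) K)) s)) := by
  set E : Set (Sym2 V) := insert s(s, Q) (insert s(Q, P) K) with hEdef
  have hsQE : s(s, Q) ∈ E := Set.mem_insert _ _
  have hQPE : s(Q, P) ∈ E := Set.mem_insert_of_mem _ (Set.mem_insert _ _)
  have hne : s(s, Q) ≠ s(Q, P) := by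
    intro h
    rcases Sym2.eq_iff.1 h with ⟨h1, -⟩ | ⟨h2, -⟩
    · exact hsQ h1
    · exact hsP h2
  -- `sQ` blue ⇒ `Q ∈ Y_E T`
  have hQY' : ∀ T : Set (Sym2 V), s(s, Q) ∉ T → Q ∈ openCluster (Tᶜ ∩ E) s := fun T hT =>
    TwoStage.Cone.mem_cluster_of_adj (mem_openCluster_self _ s) ((openGraph_adj _ s Q).2 ⟨⟨hT, hsQE⟩, hsQ⟩)
  -- both red ⇒ `Q ∉ Y_E T` and `P ∈ X_E T`
  have hQY : ∀ T : Set (Sym2 V), s(s, Q) ∈ T → s(Q, P) ∈ T → Q ∉ openCluster (Tᶜ ∩ E) s := by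
    intro T h1 h2 hQ
    obtain ⟨u, hu⟩ := exists_pair_of_mem_cluster hsQ.symm hQ
    rcases hu.2 with h | h | h
    · exact hu.1 (h ▸ h1)
    · exact hu.1 (h ▸ h2)
    · exact hQK _ h (Sym2.mem_mk_left Q u)
  have hPX : ∀ T : Set (Sym2 V), s(s, Q) ∈ T → s(Q, P) ∈ T → P ∈ openCluster (T ∩ E) s := fun T h1 h2 =>
    TwoStage.Cone.mem_cluster_of_adj
      (TwoStage.Cone.mem_cluster_of_adj (mem_openCluster_self _ s) ((openGraph_adj _ s Q).2 ⟨⟨h1, hsQE⟩, hsQ⟩))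
      ((openGraph_adj _ Q P).2 ⟨⟨h2, hQPE⟩, hPQ.symm⟩)
  -- split the event along the colour of `QP`
  rw [← Finset.sum_filter_add_sum_filter_not _ (fun T : Set (Sym2 V) => s(Q, P) ∈ T), Finset.filter_filter, Finset.filter_filter]
  refine add_nonneg ?_ ?_
  · -- `QP` red: the cylinder `{sQ, QP} ⊆ T`
    have hev : Finset.univ.filter (fun T : Set (Sym2 V) =>
          (P ∈ openCluster (T ∩ E) s ∧ Q ∉ openCluster (Tᶜ ∩ E) s) ∧ s(Q, P) ∈ T) =
        Finset.univ.filter (fun T : Set (Sym2 V) => ({s(s, Q), s(Q, P)} : Set (Sym2 V)) ⊆ T) := by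
      refine Finset.filter_congr fun T _ => ⟨fun hT => ?_, fun hT => ?_⟩
      · have h1 : s(s, Q) ∈ T := by_contra fun hc => hT.1.2 (hQY' T hc)
        intro e he
        rcases he with rfl | he
        · exact h1
        · rw [Set.mem_singleton_iff.1 he]; exact hT.2
      · have h1 : s(s, Q) ∈ T := hT (Set.mem_insert _ _)
        have h2 : s(Q, P) ∈ T := hT (Set.mem_insert_of_mem _ rfl)
        exact ⟨⟨hPX T h1 h2, hQY T h1 h2⟩, h2⟩
    rw [hev]
    exact NestedTop.cylinder_shift_sum_nonneg E s _ Fp Fm Gp Gm hFp hFm hF hGp hGm hG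
  · -- `QP` blue: the TOP event of `K` at `P`, via block Fubini over the block `A = {sQ, QP}`
    set A : Set (Sym2 V) := {s(s, Q), s(Q, P)} with hAdef
    have hAK : ∀ e ∈ A, e ∉ K := by
      intro e he heK
      rcases he with rfl | he
      · exact hQK _ heK (Sym2.mem_mk_right s Q)
      · rw [Set.mem_singleton_iff.1 he] at heK; exact hQK _ heK (Sym2.mem_mk_left Q P)
    -- the shifted pair
    let Fq : Set V → ℝ := fun S => Fp (insert Q S)
    let Gq : Set V → ℝ := fun S => Gp (insert Q S)
    have hFq : Monotone Fq := fun S S' h => hFp (Set.insert_subset_insert h)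
    have hGq : Monotone Gq := fun S S' h => hGp (Set.insert_subset_insert h)
    have hFq' : ∀ S, Fm S ≤ Fq S := fun S => (hF S).trans (hFp (Set.subset_insert _ _))
    have hGq' : ∀ S, Gm S ≤ Gq S := fun S => (hG S).trans (hGp (Set.subset_insert _ _))
    -- the TOP summand of `K` (zero off the event)
    let g : Set (Sym2 V) → ℝ := fun T =>
      if P ∈ openCluster (T ∩ K) s ∧ P ∉ openCluster (Tᶜ ∩ K) s then
        (Fq (openCluster (T ∩ K) s) - Fm (openCluster (Tᶜ ∩ K) s)) * (Gq (openCluster (T ∩ K) s) - Gm (openCluster (Tᶜ ∩ K) s))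
      else 0
    have hg_nonneg : 0 ≤ ∑ T : Set (Sym2 V), g T := by
      rw [← Finset.sum_filter]
      exact htop Fq Fm Gq Gm hFq hFm hFq' hGq hGm hGq'
    have hg_diff : ∀ T : Set (Sym2 V), g (T \ A) = g T := by
      intro T
      simp only [g, inter_diff_eq hAK, compl_diff_inter_eq hAK]
    -- block Fubini
    set N : ℝ := (Fintype.card (Set (Sym2 V)) : ℝ) with hN
    have hNpos : 0 < N := by rw [hN]; exact_mod_cast Fintype.card_pos
    have hblock := TwoStage.Cone.sum_block A (fun a b : Set (Sym2 V) => if a = {s(s, Q)} then g b else 0)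
    have hL : ∑ T : Set (Sym2 V), ∑ T' : Set (Sym2 V),
        (fun a b : Set (Sym2 V) => if a = {s(s, Q)} then g b else 0) (T ∩ A) (T' \ A)
        = (∑ T : Set (Sym2 V), (if T ∩ A = {s(s, Q)} then (1 : ℝ) else 0)) * ∑ T' : Set (Sym2 V), g T' := by
      rw [Finset.sum_mul]
      refine Finset.sum_congr rfl fun T _ => ?_
      show ∑ T', (if T ∩ A = {s(s, Q)} then g (T' \ A) else 0) = _
      by_cases hTA : T ∩ A = {s(s, Q)}
      · rw [if_pos hTA, one_mul]
        exact Finset.sum_congr rfl fun T' _ => by rw [if_pos hTA, hg_diff]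
      · rw [if_neg hTA, zero_mul]
        exact Finset.sum_eq_zero fun T' _ => by rw [if_neg hTA]
    have hR : ∑ T : Set (Sym2 V), (fun a b : Set (Sym2 V) => if a = {s(s, Q)} then g b else 0) (T ∩ A) (T \ A)
        = ∑ T : Set (Sym2 V), if T ∩ A = {s(s, Q)} then g T else 0 := by
      refine Finset.sum_congr rfl fun T _ => ?_
      show (if T ∩ A = {s(s, Q)} then g (T \ A) else 0) = _
      rw [hg_diff]
    rw [hL, hR] at hblock
    have hcnt : 0 ≤ ∑ T : Set (Sym2 V), (if T ∩ A = {s(s, Q)} then (1 : ℝ) else 0) :=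
      Finset.sum_nonneg fun T _ => by split_ifs <;> norm_num
    have h2 : 0 ≤ N * ∑ T : Set (Sym2 V), (if T ∩ A = {s(s, Q)} then g T else 0) := by
      rw [← hblock]; exact mul_nonneg hcnt hg_nonneg
    have h3 : 0 ≤ ∑ T : Set (Sym2 V), (if T ∩ A = {s(s, Q)} then g T else 0) := (mul_nonneg_iff_of_pos_left hNpos).1 h2
    -- identify the `QP`-blue part with this sum
    have hiff : ∀ T : Set (Sym2 V), T ∩ A = {s(s, Q)} ↔ (s(s, Q) ∈ T ∧ s(Q, P) ∉ T) := by
      intro T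
      constructor
      · intro h
        have h1 : s(s, Q) ∈ T ∩ A := by rw [h]; rfl
        refine ⟨h1.1, fun h2 => ?_⟩
        have : s(Q, P) ∈ T ∩ A := ⟨h2, Set.mem_insert_of_mem _ rfl⟩
        rw [h] at this
        exact hne (Set.mem_singleton_iff.1 this).symm
      · rintro ⟨h1, h2⟩
        ext e
        simp only [Set.mem_inter_iff, Set.mem_singleton_iff, hAdef, Set.mem_insert_iff]
        constructor
        · rintro ⟨he, rfl | rfl⟩
          · rfl
          · exact absurd he h2
        · rintro rfl; exact ⟨h1, Or.inl rfl⟩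
    have hsum : ∑ T ∈ Finset.univ.filter (fun T : Set (Sym2 V) =>
          (P ∈ openCluster (T ∩ E) s ∧ Q ∉ openCluster (Tᶜ ∩ E) s) ∧ ¬ s(Q, P) ∈ T),
        (Fp (openCluster (T ∩ E) s) - Fm (openCluster (Tᶜ ∩ E) s)) * (Gp (openCluster (T ∩ E) s) - Gm (openCluster (Tᶜ ∩ E) s))
        = ∑ T : Set (Sym2 V), if T ∩ A = {s(s, Q)} then g T else 0 := by
      rw [Finset.sum_filter]
      refine Finset.sum_congr rfl fun T _ => ?_
      by_cases hev : (P ∈ openCluster (T ∩ E) s ∧ Q ∉ openCluster (Tᶜ ∩ E) s) ∧ ¬ s(Q, P) ∈ T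
      · obtain ⟨⟨hPXT, hQYT⟩, h2⟩ := hev
        have h1 : s(s, Q) ∈ T := by_contra fun hc => hQYT (hQY' T hc)
        have hPY : P ∉ openCluster (Tᶜ ∩ E) s := fun hP =>
          hQYT (TwoStage.Cone.mem_cluster_of_adj hP ((openGraph_adj _ P Q).2
            ⟨⟨by rw [Sym2.eq_swap]; exact h2, by rw [Sym2.eq_swap]; exact hQPE⟩, hPQ⟩))
        have hPYK : P ∉ openCluster (Tᶜ ∩ K) s := fun hP => hPY (Freeze.openCluster_mono
          (Set.inter_subset_inter_right Tᶜ ((Set.subset_insert _ _).trans (Set.subset_insert _ _))) s hP)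
        have hXeq : openCluster (T ∩ E) s = insert Q (openCluster (T ∩ K) s) := red_cluster_eq hsQ hQK h1 h2
        have hYeq : openCluster (Tᶜ ∩ E) s = openCluster (Tᶜ ∩ K) s := blue_cluster_eq hsQ hQK h1 hPYK
        have hPXK : P ∈ openCluster (T ∩ K) s := by
          have := hPXT; rw [hXeq] at this
          rcases this with h | h
          · exact absurd h hPQ
          · exact h
        rw [if_pos ⟨⟨hPXT, hQYT⟩, h2⟩, if_pos ((hiff T).2 ⟨h1, h2⟩)]
        simp only [g, if_pos (show P ∈ openCluster (T ∩ K) s ∧ P ∉ openCluster (Tᶜ ∩ K) s from ⟨hPXK, hPYK⟩), Fq, Gq, hXeq, hYeq]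
      · rw [if_neg hev]
        by_cases hTA : T ∩ A = {s(s, Q)}
        · obtain ⟨h1, h2⟩ := (hiff T).1 hTA
          rw [if_pos hTA]
          -- the `K`-event fails, so `g T = 0`
          have hnot : ¬ (P ∈ openCluster (T ∩ K) s ∧ P ∉ openCluster (Tᶜ ∩ K) s) := by
            rintro ⟨hPXK, hPYK⟩
            refine hev ⟨⟨?_, ?_⟩, h2⟩
            · rw [red_cluster_eq hsQ hQK h1 h2]; exact Set.mem_insert_of_mem _ hPXK
            · rw [blue_cluster_eq hsQ hQK h1 hPYK]
              intro hQ
              obtain ⟨u', hu'⟩ := exists_pair_of_mem_cluster hsQ.symm hQ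
              exact hQK _ hu'.2 (Sym2.mem_mk_left Q u')
          simp only [g, if_neg hnot]
        · rw [if_neg hTA]
    rw [hsum]
    exact h3

/-- **THEOREM T-EAR (any core plus a chorded ear at `s`, conditional on the TOP hypothesis of the core).**  `K` loop-free avoiding `Q`;
`s, P, Q` pairwise distinct; TOP_shift(K; P) (module docstring); an arm `P = u 0, u 1, …, u a = y` of fresh vertices; `x` fresh joined to
`y` and `Q` (`y ≠ Q`, `yQ ∉ (K + sQ + QP) ∪ arm`).  Then for all monotone `F, G`:
`0 ≤ Σ_{ω : ¬(x ∈ X_E ω ∧ x ∈ Y_E ω)} (F(X_E ω) − F(Y_E ω))·(G(X_E ω) − G(Y_E ω))`, `E = ((K + sQ + QP) ∪ arm) + xQ + xy` — the vertex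
antithetic inequality at `R = {x}` for `K` plus the cycle `Q – P – … – y – x – Q` plus the chord `sQ`. [this work] -/
theorem chorded_ear_vertex_sum_nonneg {K : Set (Sym2 V)} {s P Q : V} {u : ℕ → V} {a : ℕ}
    (hnd : ∀ f ∈ K, ¬ f.IsDiag) (hQK : ∀ e ∈ K, Q ∉ e) (hsQ : s ≠ Q) (hPQ : P ≠ Q) (hsP : s ≠ P)
    (htop : ∀ Fp Fm Gp Gm : Set V → ℝ, Monotone Fp → Monotone Fm → (∀ S, Fm S ≤ Fp S) →
      Monotone Gp → Monotone Gm → (∀ S, Gm S ≤ Gp S) →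
      0 ≤ ∑ T ∈ Finset.univ.filter (fun T : Set (Sym2 V) => P ∈ openCluster (T ∩ K) s ∧ P ∉ openCluster (Tᶜ ∩ K) s),
        (Fp (openCluster (T ∩ K) s) - Fm (openCluster (Tᶜ ∩ K) s)) * (Gp (openCluster (T ∩ K) s) - Gm (openCluster (Tᶜ ∩ K) s)))
    (hu0 : u 0 = P) (hufresh : ∀ i, 0 < i → i ≤ a → ∀ f ∈ insert s(s, Q) (insert s(Q, P) K), u i ∈ f → f.IsDiag)
    (huinj : ∀ i j, i ≤ a → j ≤ a → u i = u j → i = j) (hsu : ∀ i, 0 < i → i ≤ a → s ≠ u i) (hQu : ∀ i, 0 < i → i ≤ a → Q ≠ u i)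
    {x : V} (hx : ∀ f ∈ insert s(s, Q) (insert s(Q, P) K) ∪ Cyc.edgeSet a u, x ∈ f → f.IsDiag) (hxs : x ≠ s) (hxy : x ≠ u a)
    (hxQ : x ≠ Q) (hyQ : u a ≠ Q) (hg : s(u a, Q) ∉ insert s(s, Q) (insert s(Q, P) K) ∪ Cyc.edgeSet a u)
    {F G : Set V → ℝ} (hF : Monotone F) (hG : Monotone G) :
    0 ≤ ∑ ω ∈ Finset.univ.filter (fun ω : Set (Sym2 V) =>
        ¬ ((openGraph (ω ∩ insert s(x, Q) (insert s(x, u a)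
              (insert s(s, Q) (insert s(Q, P) K) ∪ Cyc.edgeSet a u)))).Reachable s x ∧
          (openGraph (ωᶜ ∩ insert s(x, Q) (insert s(x, u a)
              (insert s(s, Q) (insert s(Q, P) K) ∪ Cyc.edgeSet a u)))).Reachable s x)),
      (F (openCluster (ω ∩ insert s(x, Q) (insert s(x, u a) (insert s(s, Q) (insert s(Q, P) K) ∪ Cyc.edgeSet a u))) s) -
          F (openCluster (ωᶜ ∩ insert s(x, Q) (insert s(x, u a) (insert s(s, Q) (insert s(Q, P) K) ∪ Cyc.edgeSet a u))) s)) *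
        (G (openCluster (ω ∩ insert s(x, Q) (insert s(x, u a) (insert s(s, Q) (insert s(Q, P) K) ∪ Cyc.edgeSet a u))) s) -
          G (openCluster (ωᶜ ∩ insert s(x, Q) (insert s(x, u a) (insert s(s, Q) (insert s(Q, P) K) ∪ Cyc.edgeSet a u))) s)) := by
  set E₀ : Set (Sym2 V) := insert s(s, Q) (insert s(Q, P) K) with hE₀
  have hnd₀ : ∀ f ∈ E₀, ¬ f.IsDiag := by
    intro f hf
    rcases hf with rfl | rfl | hf
    · rw [Sym2.mk_isDiag_iff]; exact hsQ
    · rw [Sym2.mk_isDiag_iff]; exact hPQ.symm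
    · exact hnd f hf
  -- (M)_shift(E₀; P, Q) by LEMMA D2Q-T
  have hmix : ∀ Fp Fm Gp Gm : Set V → ℝ, Monotone Fp → Monotone Fm → (∀ S, Fm S ≤ Fp S) →
      Monotone Gp → Monotone Gm → (∀ S, Gm S ≤ Gp S) →
      0 ≤ ∑ T ∈ Finset.univ.filter (fun T : Set (Sym2 V) =>
          P ∈ openCluster (T ∩ E₀) s ∧ Q ∉ openCluster (Tᶜ ∩ E₀) s),
        (Fp (openCluster (T ∩ E₀) s) - Fm (openCluster (Tᶜ ∩ E₀) s)) *
          (Gp (openCluster (T ∩ E₀) s) - Gm (openCluster (Tᶜ ∩ E₀) s)) :=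
    fun Fp Fm Gp Gm hFp hFm hF' hGp hGm hG' =>
      mixed_shift_nonneg_of_top K s P Q hsQ hPQ hsP hQK htop Fp Fm Gp Gm hFp hFm hF' hGp hGm hG'
  -- the `z`-arm of length `0`
  let w : ℕ → V := fun _ => Q
  have hw0 : w 0 = Q := rfl
  have hE : Cyc.edgeSet a u ∪ E₀ = (Cyc.edgeSet a u ∪ E₀) ∪ Cyc.edgeSet 0 w := by
    rw [TwoStage.Cone.edgeSet_zero, Set.union_empty]
  have hufresh' : ∀ i, 0 < i → i ≤ a → ∀ f ∈ E₀ ∪ Cyc.edgeSet 0 w, u i ∈ f → f.IsDiag := by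
    intro i hi hia f hf huf
    rw [TwoStage.Cone.edgeSet_zero, Set.union_empty] at hf
    exact hufresh i hi hia f hf huf
  have hx' : ∀ f ∈ Cyc.edgeSet a u ∪ E₀, x ∈ f → f.IsDiag := by rw [Set.union_comm]; exact hx
  have hg' : s(u a, Q) ∉ Cyc.edgeSet a u ∪ E₀ := by rw [Set.union_comm]; exact hg
  have h := Pendant.handle_vertex_sum_nonneg_of_shift (E₀ := E₀) (s := s) (P := P) (Q := Q) (u := u) (w := w) (a := a) (b := 0)
    hu0 hw0 hufresh' (fun i hi hib => absurd hib (by omega)) huinj (fun i j hi hj _ => by omega) hsu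
    (fun i hi hib => absurd hib (by omega)) (fun i hi hib => absurd hib (by omega)) hQu
    (fun j hj => absurd hj (Nat.not_lt_zero j)) hmix hnd₀ (x := x) (by rw [← hE]; exact hx') hxs hxy hxQ hyQ (by rw [← hE]; exact hg')
    hF hG
  rw [← hE, hw0] at h
  have hset : insert s(x, Q) (insert s(x, u a) (E₀ ∪ Cyc.edgeSet a u)) = insert s(x, u a) (insert s(x, Q) (Cyc.edgeSet a u ∪ E₀)) := by
    rw [Set.insert_comm, Set.union_comm]
  rw [hset]
  convert h using 3

end TopEar

end Antithetic

end Summit.CriticalPhenomena.PercolationContinuityZ3.Theorems
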